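import Summits.ResolutionOfSingularities.ResolutionOfSingularities.Theorems.FrobeniusLadderFInjectiveMacaulayficationCentreSpread
import Literature.AlgebraicGeometry.Resolution.MarkedIdealsArithmetic
import Literature.AlgebraicGeometry.Resolution.MarkedIdealsLemmas
import Literature.AlgebraicGeometry.Resolution.CanonicalResolutionSmoothCentre
import Mathlib.RingTheory.Finiteness.Ideal
import HarnessLib

/-!
# MULTI-POINT PRESCRIBED-STALK SPREAD from an affine open, with support control at finitely many points
# (crux `FInjectiveMacaulayfication` stmt-ResolutionOfSingularities-15315, chain w45a; res-L1-w45a-plan-1 R16.54 (2)/R16.56 — the spread step of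
# `clusterGrowth_multi` (simultaneous dominating cure at finitely many points): the semi-local centre, contracted to `Γ(X, U₀)`, is spread to an ideal
# sheaf with the prescribed stalk at EVERY point of `U₀`; seat res-L1-w45a-stub-2)

[OURS · L1 W4.5a] Support file (`--supports stmt-ResolutionOfSingularities-15315 --as helper`); NOT a statement of any manuscript; def-free, unconditional;
AI-written (AI review is weaker than expert review).

* `exists_spread_of_ideal U 𝔟`: for an affine open `U` of a locally Noetherian `X` and ANY ideal `𝔟 ≤ Γ(X, U)` there is an ideal sheaf `J` with
  `J(U) = 𝔟`, hence `J_ζ = 𝔟·𝒪_{X,ζ}` at every `ζ ∈ U` (`CentreSpread.exists_idealSheafData_ideal_eq` + `stalkIdeal_eq_map_germ`) — compatibility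
  among finitely many prescribed points is automatic once their stalk ideals come from ONE `𝔟` (e.g. the contraction of a semi-local ideal).
* `exists_spread_of_ideal_support_subset`: if moreover at finitely many `ζ_i ∈ U` the stalk of the ideal of a closed `Z` lies in `√(𝔟·𝒪_{ζ_i})`, then
  `J″ := J ⊔ I_Z^N` (one uniform `N`) has the same stalks at all `ζ_i` and `supp J″ ⊆ Z`.
* `ne_bot_of_stalkIdeal_ne_bot`: such a `J″` is `≠ ⊥` as soon as one prescribed stalk is.
-/

-- single-problem summit: the doubled namespace component is forced
set_option linter.dupNamespace false

noncomputable section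

namespace Summit.ResolutionOfSingularities.ResolutionOfSingularities.Theorems.FInjectiveMacaulayfication.SpreadMulti

open CategoryTheory AlgebraicGeometry TopologicalSpace IsLocalRing
open Literature.AlgebraicGeometry.Resolution
open Summit.ResolutionOfSingularities.ResolutionOfSingularities.Theorems.FInjectiveMacaulayfication

/-- **Spread of an ideal of sections of an affine open**, with the prescribed stalk at EVERY point of the open. [folklore] -/
theorem exists_spread_of_ideal (X : Scheme.{0}) [IsLocallyNoetherian X] (U : X.affineOpens) (𝔟 : Ideal Γ(X, U)) :
    ∃ J : X.IdealSheafData, J.ideal U = 𝔟 ∧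
      ∀ (ζ : X) (hζ : ζ ∈ (U : X.Opens)), stalkIdeal J ζ = 𝔟.map (X.presheaf.germ U ζ hζ).hom := by
  obtain ⟨J, hJU⟩ := CentreSpread.exists_idealSheafData_ideal_eq X U 𝔟
  exact ⟨J, hJU, fun ζ hζ => by rw [stalkIdeal_eq_map_germ J U hζ, hJU]⟩

/-- **Support control at finitely many points.** [folklore] -/
theorem exists_spread_of_ideal_support_subset (X : Scheme.{0}) [IsLocallyNoetherian X] (U : X.affineOpens) (𝔟 : Ideal Γ(X, U))
    (Z : Set X) (hZ : IsClosed Z) {m : ℕ} (ζs : Fin m → X) (hζ : ∀ i, ζs i ∈ (U : X.Opens))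
    (hrad : ∀ i, stalkIdeal (Scheme.IdealSheafData.vanishingIdeal ⟨Z, hZ⟩) (ζs i) ≤ (𝔟.map (X.presheaf.germ U (ζs i) (hζ i)).hom).radical) :
    ∃ J'' : X.IdealSheafData, (∀ i, stalkIdeal J'' (ζs i) = 𝔟.map (X.presheaf.germ U (ζs i) (hζ i)).hom) ∧ (J''.support : Set X) ⊆ Z := by
  classical
  obtain ⟨J, -, hJ⟩ := exists_spread_of_ideal X U 𝔟
  -- one uniform exponent
  have hN : ∀ i, ∃ N : ℕ, stalkIdeal (Scheme.IdealSheafData.vanishingIdeal ⟨Z, hZ⟩) (ζs i) ^ N ≤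
      𝔟.map (X.presheaf.germ U (ζs i) (hζ i)).hom := fun i =>
    Ideal.exists_pow_le_of_le_radical_of_fg (hrad i) (IsNoetherian.noetherian _)
  choose N hN using hN
  let M : ℕ := Finset.univ.sup N + 1
  have hM : ∀ i, N i ≤ M := fun i => (Finset.le_sup (Finset.mem_univ i)).trans (Nat.le_succ _)
  refine ⟨J ⊔ Scheme.IdealSheafData.vanishingIdeal ⟨Z, hZ⟩ ^ M, fun i => ?_, ?_⟩
  · rw [stalkIdeal_sup, stalkIdeal_pow, hJ (ζs i) (hζ i)]
    exact sup_eq_left.mpr ((Ideal.pow_le_pow_right (hM i)).trans (hN i))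
  · intro x hx
    rw [Scheme.IdealSheafData.support_sup] at hx
    have hx' : x ∈ ((Scheme.IdealSheafData.vanishingIdeal ⟨Z, hZ⟩ ^ M).support : Set X) := hx.2
    rw [show M = Finset.univ.sup N + 1 from rfl, Scheme.IdealSheafData.support_pow_succ,
      Scheme.IdealSheafData.coe_support_vanishingIdeal] at hx'
    exact hx'

/-- An ideal sheaf with a nonzero stalk somewhere is nonzero. [plumbing] -/
theorem ne_bot_of_stalkIdeal_ne_bot {X : Scheme.{0}} (J : X.IdealSheafData) (ζ : X) (h : stalkIdeal J ζ ≠ ⊥) : J ≠ ⊥ := by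
  rintro rfl
  exact h (stalkIdeal_bot ζ)

/-- **Combined form** (what `clusterGrowth_multi` consumes): prescribed stalks `𝔟·𝒪_{ζ_i}` at finitely many points of one affine open, support inside
`Z`, and `J″ ≠ ⊥` as soon as one `𝔟·𝒪_{ζ_i} ≠ ⊥`. [folklore] -/
theorem exists_spread_multi (X : Scheme.{0}) [IsLocallyNoetherian X] (U : X.affineOpens) (𝔟 : Ideal Γ(X, U))
    (Z : Set X) (hZ : IsClosed Z) {m : ℕ} (ζs : Fin m → X) (hζ : ∀ i, ζs i ∈ (U : X.Opens))
    (hrad : ∀ i, stalkIdeal (Scheme.IdealSheafData.vanishingIdeal ⟨Z, hZ⟩) (ζs i) ≤ (𝔟.map (X.presheaf.germ U (ζs i) (hζ i)).hom).radical)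
    (i₀ : Fin m) (h0 : 𝔟.map (X.presheaf.germ U (ζs i₀) (hζ i₀)).hom ≠ ⊥) :
    ∃ J'' : X.IdealSheafData, J'' ≠ ⊥ ∧ (∀ i, stalkIdeal J'' (ζs i) = 𝔟.map (X.presheaf.germ U (ζs i) (hζ i)).hom) ∧
      (J''.support : Set X) ⊆ Z := by
  obtain ⟨J'', hJ'', hZ'⟩ := exists_spread_of_ideal_support_subset X U 𝔟 Z hZ ζs hζ hrad
  exact ⟨J'', ne_bot_of_stalkIdeal_ne_bot J'' (ζs i₀) (by rw [hJ'' i₀]; exact h0), hJ'', hZ'⟩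

end Summit.ResolutionOfSingularities.ResolutionOfSingularities.Theorems.FInjectiveMacaulayfication.SpreadMulti

end
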